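import Summits.HodgeConjecture.CorCM.Census.CyclicCharacterNearLinearisation

/-!
# Cyclic characters, XX: STRICT LINEARISATION — relations from any cover beyond half a fibre

COR-CM (cell `pub-hodgecm2`), count-neutral kernel combinatorics by the binder seat b09 (gen 42; lane CYCLIC-CHARACTER FIBRE LAW, part XX), on part XVII
(`Census/CyclicCharacterNearLinearisation.lean`) BY NAME.  Theorems only (no definition, no `decide`, no certificate, no named fact, no `sorry`).
HONEST FRAMING: `HC_CM` is NOT proved, here or anywhere in the tree; nothing here is a period or a headline.

Part XVII linearises, through the toward faces of ANY cover, every type within HALF A FIBRE of an arc type — enough for `k = 2` (part XIX, the ℤ/4-Sylow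
law).  For `k ≥ 3` the interior arc shifts come from SPECTATOR equator faces (an interior point flipped throughout), one of whose corners sits at distance
exactly `(|ker w| + 1)/2` from its nearest arc type: outside the half-fibre zone, although the nearest arc type is still unique.  This file removes the
half-fibre hypothesis: the one-sided linearisation runs as soon as the nearest arc type is UNIQUE along the whole deviation lattice below the type
(`single_sub_normalForm_mem_of_toward_of_unique`), and a face in `L` whose four corners have this property yields the alternating sum of their normal
forms (`alt_normalForm_mem_of_gface_mem_of_unique`).  The uniqueness hypothesis is a plain statement about deviation distances which each column
verifies by counting fibres; part XVIIʼs half-fibre criterion is recovered as the special case `rt_arcType_eq_of_bpot_eq`.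
-/

namespace Summit.HodgeConjecture.CorCM.Census.CyclicCharacter

open Finset
open Summit.HodgeConjecture.CorCM.Prior.AllgGroup.RfwfAllgGroup
open Summit.HodgeConjecture.CorCM.Census.BlockParity
open Summit.HodgeConjecture.CorCM.Census.Coinvariant
open Summit.HodgeConjecture.CorCM.Census.TwistGeneration
open Summit.HodgeConjecture.CorCM.Census.Nondegenerate
open Summit.HodgeConjecture.CorCM.Census.BaseBlock

noncomputable section

variable {G : Type*} [Group G] [Fintype G] [DecidableEq G] {k : ℕ} {w : G → ZMod (2 ^ k)} {c : G}

/-- **ONE-SIDED LINEARISATION UNDER UNIQUENESS OF THE NEAREST ARC TYPE**, `thetaG` form: if `L` has a toward face through every type of potential `≥ 2`,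
`T = T_0·Q₀⁻¹`, and every type deviating from `T` inside `T ∖ Φ` has `T` as its ONLY nearest arc type, then `[Φ] − θ_T(1_Φ) ∈ L`. [folklore] -/
theorem single_sub_thetaG_mem_of_toward_of_unique (hw : ∀ P Q : G, w (P * Q) = w P + w Q) (hk : 1 ≤ k) (hc2 : c * c = 1) (hwc : w c ≠ 0)
    (L : Submodule ℤ (CMF G c →₀ ℤ))
    (htw : ∀ Φ : CMF G c, 2 ≤ bpot c (arcType hw hk hc2 hwc 0) Φ → ∃ Q t t' : G,
      bpot c (arcType hw hk hc2 hwc 0) Φ = ddist (rt c Q (arcType hw hk hc2 hwc 0)) Φ ∧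
        t ∈ (rt c Q (arcType hw hk hc2 hwc 0)).1 \ Φ.1 ∧ t' ∈ (rt c Q (arcType hw hk hc2 hwc 0)).1 \ Φ.1 ∧ t ≠ t' ∧ gface c hc2 Φ t t' ∈ L)
    (Q₀ : G) :
    ∀ (m : ℕ) (Φ : CMF G c), ((rt c Q₀ (arcType hw hk hc2 hwc 0)).1 \ Φ.1).card = m →
      (∀ Ψ : CMF G c, (rt c Q₀ (arcType hw hk hc2 hwc 0)).1 \ Ψ.1 ⊆ (rt c Q₀ (arcType hw hk hc2 hwc 0)).1 \ Φ.1 →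
        ∀ Q : G, bpot c (arcType hw hk hc2 hwc 0) Ψ = ddist (rt c Q (arcType hw hk hc2 hwc 0)) Ψ →
          rt c Q (arcType hw hk hc2 hwc 0) = rt c Q₀ (arcType hw hk hc2 hwc 0)) →
      Finsupp.single Φ (1 : ℤ) - thetaG c hc2 (rt c Q₀ (arcType hw hk hc2 hwc 0)) (typeSum G c (Finsupp.single Φ 1)) ∈ L := by
  set T := rt c Q₀ (arcType hw hk hc2 hwc 0) with hT
  intro m
  induction m using Nat.strong_induction_on with
  | h m ih =>
  intro Φ hm huniq
  rcases m with _ | (_ | m)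
  · have hΦ : Φ = T := eq_of_dev_empty c (Finset.card_eq_zero.mp hm)
    rw [hΦ, thetaG_typeSum_single, sdiff_self, Finset.bot_eq_empty, Finset.sum_empty, zero_add, sub_self]
    exact Submodule.zero_mem _
  · obtain ⟨s, hs⟩ := Finset.card_eq_one.mp hm
    have hd : Φ = oflipCM c hc2 s T := eq_oflip_of_dev_singleton c hc2 hs
    rw [thetaG_typeSum_single, hs, Finset.sum_singleton, hd, sub_add_cancel, sub_self]
    exact Submodule.zero_mem _
  · -- the potential of `Φ` is its distance from `T`, by uniqueness at `Φ` itself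
    have hdd : ddist T Φ = m + 2 := hm
    obtain ⟨Q₁, hQ₁⟩ := exists_bpot_eq c (arcType hw hk hc2 hwc 0) Φ
    have hQ₁T : rt c Q₁ (arcType hw hk hc2 hwc 0) = T := huniq Φ subset_rfl Q₁ hQ₁
    have hbpot : bpot c (arcType hw hk hc2 hwc 0) Φ = m + 2 := by rw [hQ₁, hQ₁T, hdd]
    obtain ⟨Q, s, s', hQ, hsD, hs'D, hss', hface⟩ := htw Φ (by omega)
    have hQT : rt c Q (arcType hw hk hc2 hwc 0) = T := huniq Φ subset_rfl Q hQ
    rw [hQT] at hsD hs'D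
    have hsT : s ∈ T.1 := (Finset.mem_sdiff.mp hsD).1
    have hsΦ : s ∉ Φ.1 := (Finset.mem_sdiff.mp hsD).2
    have hs'T : s' ∈ T.1 := (Finset.mem_sdiff.mp hs'D).1
    have hs'Φ : s' ∉ Φ.1 := (Finset.mem_sdiff.mp hs'D).2
    have hs'O : s' ∉ orb c s := by
      rw [mem_orb]
      rintro (h1 | h1)
      · exact hss' h1.symm
      · exact ((T.2 s).mp hsT) (h1 ▸ hs'T)
    have hdv1 : T.1 \ (oflipCM c hc2 s Φ).1 = (T.1 \ Φ.1).erase s := dev_oflip c hc2 hsT hsΦ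
    have hdv2 : T.1 \ (oflipCM c hc2 s' Φ).1 = (T.1 \ Φ.1).erase s' := dev_oflip c hc2 hs'T hs'Φ
    have hsflip : s ∉ (oflipCM c hc2 s' Φ).1 := by
      show s ∉ oflip c s' Φ.1
      have hsO' : s ∉ orb c s' := by
        rw [mem_orb]
        rintro (h1 | h1)
        · exact hss' h1
        · exact ((T.2 s').mp hs'T) (h1 ▸ hsT)
      intro hmem
      rw [oflip, Finset.mem_symmDiff] at hmem
      rcases hmem with ⟨h1, -⟩ | ⟨h1, -⟩
      · exact hsΦ h1
      · exact hsO' h1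
    have hdv3 : T.1 \ (oflipCM c hc2 s (oflipCM c hc2 s' Φ)).1 = ((T.1 \ Φ.1).erase s').erase s := by
      rw [dev_oflip c hc2 hsT hsflip, hdv2]
    have hdev1 : (T.1 \ (oflipCM c hc2 s Φ).1).card = m + 1 := by rw [hdv1, Finset.card_erase_of_mem hsD]; omega
    have hdev2 : (T.1 \ (oflipCM c hc2 s' Φ).1).card = m + 1 := by rw [hdv2, Finset.card_erase_of_mem hs'D]; omega
    have hdev3 : (T.1 \ (oflipCM c hc2 s (oflipCM c hc2 s' Φ)).1).card = m := by
      rw [hdv3, Finset.card_erase_of_mem (Finset.mem_erase.mpr ⟨hss', hsD⟩), Finset.card_erase_of_mem hs'D]; omega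
    -- uniqueness is inherited by the three lower corners (their deviation sets are smaller)
    have hu1 := fun Ψ (hΨ : T.1 \ Ψ.1 ⊆ T.1 \ (oflipCM c hc2 s Φ).1) => huniq Ψ (hΨ.trans (by rw [hdv1]; exact erase_subset _ _))
    have hu2 := fun Ψ (hΨ : T.1 \ Ψ.1 ⊆ T.1 \ (oflipCM c hc2 s' Φ).1) => huniq Ψ (hΨ.trans (by rw [hdv2]; exact erase_subset _ _))
    have hu3 := fun Ψ (hΨ : T.1 \ Ψ.1 ⊆ T.1 \ (oflipCM c hc2 s (oflipCM c hc2 s' Φ)).1) =>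
      huniq Ψ (hΨ.trans (by rw [hdv3]; exact (erase_subset _ _).trans (erase_subset _ _)))
    have key : Finsupp.single Φ (1 : ℤ) - thetaG c hc2 T (typeSum G c (Finsupp.single Φ 1))
        = (gface c hc2 Φ s s'
            - thetaG c hc2 T (typeSum G c (gface c hc2 Φ s s')))
          + (Finsupp.single (oflipCM c hc2 s Φ) (1 : ℤ)
              - thetaG c hc2 T (typeSum G c (Finsupp.single (oflipCM c hc2 s Φ) 1)))
          + (Finsupp.single (oflipCM c hc2 s' Φ) (1 : ℤ)
              - thetaG c hc2 T (typeSum G c (Finsupp.single (oflipCM c hc2 s' Φ) 1)))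
          - (Finsupp.single (oflipCM c hc2 s (oflipCM c hc2 s' Φ)) (1 : ℤ)
              - thetaG c hc2 T (typeSum G c (Finsupp.single (oflipCM c hc2 s (oflipCM c hc2 s' Φ)) 1))) := by
      simp only [gface, map_add, map_sub]
      abel
    rw [key]
    refine Submodule.sub_mem _ (Submodule.add_mem _ (Submodule.add_mem _ ?_ ?_) ?_) ?_
    · rw [typeSum_gface c hc2 Φ hs'O, map_zero, sub_zero]
      exact hface
    · exact ih (m + 1) (by omega) _ hdev1 hu1
    · exact ih (m + 1) (by omega) _ hdev2 hu2
    · exact ih m (by omega) _ hdev3 hu3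

/-- **ONE-SIDED LINEARISATION UNDER UNIQUENESS**, normal form. [folklore] -/
theorem single_sub_normalForm_mem_of_toward_of_unique (hw : ∀ P Q : G, w (P * Q) = w P + w Q) (hk : 1 ≤ k) (hc2 : c * c = 1) (hwc : w c ≠ 0)
    (L : Submodule ℤ (CMF G c →₀ ℤ))
    (htw : ∀ Φ : CMF G c, 2 ≤ bpot c (arcType hw hk hc2 hwc 0) Φ → ∃ Q t t' : G,
      bpot c (arcType hw hk hc2 hwc 0) Φ = ddist (rt c Q (arcType hw hk hc2 hwc 0)) Φ ∧
        t ∈ (rt c Q (arcType hw hk hc2 hwc 0)).1 \ Φ.1 ∧ t' ∈ (rt c Q (arcType hw hk hc2 hwc 0)).1 \ Φ.1 ∧ t ≠ t' ∧ gface c hc2 Φ t t' ∈ L)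
    (Q₀ : G) (Φ : CMF G c)
    (huniq : ∀ Ψ : CMF G c, (rt c Q₀ (arcType hw hk hc2 hwc 0)).1 \ Ψ.1 ⊆ (rt c Q₀ (arcType hw hk hc2 hwc 0)).1 \ Φ.1 →
      ∀ Q : G, bpot c (arcType hw hk hc2 hwc 0) Ψ = ddist (rt c Q (arcType hw hk hc2 hwc 0)) Ψ →
        rt c Q (arcType hw hk hc2 hwc 0) = rt c Q₀ (arcType hw hk hc2 hwc 0)) :
    Finsupp.single Φ (1 : ℤ) - ((∑ t ∈ (rt c Q₀ (arcType hw hk hc2 hwc 0)).1 \ Φ.1,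
      (Finsupp.single (oflipCM c hc2 t (rt c Q₀ (arcType hw hk hc2 hwc 0))) (1 : ℤ) - Finsupp.single (rt c Q₀ (arcType hw hk hc2 hwc 0)) 1)) +
        Finsupp.single (rt c Q₀ (arcType hw hk hc2 hwc 0)) 1) ∈ L := by
  rw [← thetaG_typeSum_single hc2]
  exact single_sub_thetaG_mem_of_toward_of_unique hw hk hc2 hwc L htw Q₀ _ Φ rfl huniq

/-- **The half-fibre zone satisfies the uniqueness hypothesis** (so part XVII is the special case). [folklore] -/
theorem unique_of_near (hw : ∀ P Q : G, w (P * Q) = w P + w Q) (hk : 1 ≤ k) (hc2 : c * c = 1) (hwc : w c ≠ 0) {Q₀ : G} {Φ : CMF G c}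
    (hΦ : 2 * ddist (rt c Q₀ (arcType hw hk hc2 hwc 0)) Φ < (univ.filter fun n : G => w n = 0).card) :
    ∀ Ψ : CMF G c, (rt c Q₀ (arcType hw hk hc2 hwc 0)).1 \ Ψ.1 ⊆ (rt c Q₀ (arcType hw hk hc2 hwc 0)).1 \ Φ.1 →
      ∀ Q : G, bpot c (arcType hw hk hc2 hwc 0) Ψ = ddist (rt c Q (arcType hw hk hc2 hwc 0)) Ψ →
        rt c Q (arcType hw hk hc2 hwc 0) = rt c Q₀ (arcType hw hk hc2 hwc 0) := by
  intro Ψ hΨ Q hQ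
  refine rt_arcType_eq_of_bpot_eq hw hk hc2 hwc (lt_of_le_of_lt ?_ hΦ) hQ
  exact Nat.mul_le_mul_left 2 (card_le_card hΨ)

/-- **A FACE IN `L` WHOSE CORNERS HAVE UNIQUE NEAREST ARC TYPES YIELDS A NEAR-ZONE RELATION** — the alternating sum of the four normal forms lies in `L`;
part XVIIʼs `alt_normalForm_mem_of_gface_mem` with the half-fibre conditions replaced by uniqueness. [folklore] -/
theorem alt_normalForm_mem_of_gface_mem_of_unique (hw : ∀ P Q : G, w (P * Q) = w P + w Q) (hk : 1 ≤ k) (hc2 : c * c = 1) (hwc : w c ≠ 0)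
    (L : Submodule ℤ (CMF G c →₀ ℤ))
    (htw : ∀ Φ : CMF G c, 2 ≤ bpot c (arcType hw hk hc2 hwc 0) Φ → ∃ Q t t' : G,
      bpot c (arcType hw hk hc2 hwc 0) Φ = ddist (rt c Q (arcType hw hk hc2 hwc 0)) Φ ∧
        t ∈ (rt c Q (arcType hw hk hc2 hwc 0)).1 \ Φ.1 ∧ t' ∈ (rt c Q (arcType hw hk hc2 hwc 0)).1 \ Φ.1 ∧ t ≠ t' ∧ gface c hc2 Φ t t' ∈ L)
    {Ψ : CMF G c} {t t' : G} (hf : gface c hc2 Ψ t t' ∈ L) (Q₁ Q₂ Q₃ Q₄ : G)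
    (h₁ : ∀ Ω : CMF G c, (rt c Q₁ (arcType hw hk hc2 hwc 0)).1 \ Ω.1 ⊆ (rt c Q₁ (arcType hw hk hc2 hwc 0)).1 \ Ψ.1 →
      ∀ Q : G, bpot c (arcType hw hk hc2 hwc 0) Ω = ddist (rt c Q (arcType hw hk hc2 hwc 0)) Ω →
        rt c Q (arcType hw hk hc2 hwc 0) = rt c Q₁ (arcType hw hk hc2 hwc 0))
    (h₂ : ∀ Ω : CMF G c, (rt c Q₂ (arcType hw hk hc2 hwc 0)).1 \ Ω.1 ⊆ (rt c Q₂ (arcType hw hk hc2 hwc 0)).1 \ (oflipCM c hc2 t (oflipCM c hc2 t' Ψ)).1 →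
      ∀ Q : G, bpot c (arcType hw hk hc2 hwc 0) Ω = ddist (rt c Q (arcType hw hk hc2 hwc 0)) Ω →
        rt c Q (arcType hw hk hc2 hwc 0) = rt c Q₂ (arcType hw hk hc2 hwc 0))
    (h₃ : ∀ Ω : CMF G c, (rt c Q₃ (arcType hw hk hc2 hwc 0)).1 \ Ω.1 ⊆ (rt c Q₃ (arcType hw hk hc2 hwc 0)).1 \ (oflipCM c hc2 t Ψ).1 →
      ∀ Q : G, bpot c (arcType hw hk hc2 hwc 0) Ω = ddist (rt c Q (arcType hw hk hc2 hwc 0)) Ω →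
        rt c Q (arcType hw hk hc2 hwc 0) = rt c Q₃ (arcType hw hk hc2 hwc 0))
    (h₄ : ∀ Ω : CMF G c, (rt c Q₄ (arcType hw hk hc2 hwc 0)).1 \ Ω.1 ⊆ (rt c Q₄ (arcType hw hk hc2 hwc 0)).1 \ (oflipCM c hc2 t' Ψ).1 →
      ∀ Q : G, bpot c (arcType hw hk hc2 hwc 0) Ω = ddist (rt c Q (arcType hw hk hc2 hwc 0)) Ω →
        rt c Q (arcType hw hk hc2 hwc 0) = rt c Q₄ (arcType hw hk hc2 hwc 0)) :
    (((∑ s ∈ (rt c Q₁ (arcType hw hk hc2 hwc 0)).1 \ Ψ.1,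
        (Finsupp.single (oflipCM c hc2 s (rt c Q₁ (arcType hw hk hc2 hwc 0))) (1 : ℤ) - Finsupp.single (rt c Q₁ (arcType hw hk hc2 hwc 0)) 1)) +
          Finsupp.single (rt c Q₁ (arcType hw hk hc2 hwc 0)) 1) +
      ((∑ s ∈ (rt c Q₂ (arcType hw hk hc2 hwc 0)).1 \ (oflipCM c hc2 t (oflipCM c hc2 t' Ψ)).1,
        (Finsupp.single (oflipCM c hc2 s (rt c Q₂ (arcType hw hk hc2 hwc 0))) (1 : ℤ) - Finsupp.single (rt c Q₂ (arcType hw hk hc2 hwc 0)) 1)) +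
          Finsupp.single (rt c Q₂ (arcType hw hk hc2 hwc 0)) 1)) -
      ((∑ s ∈ (rt c Q₃ (arcType hw hk hc2 hwc 0)).1 \ (oflipCM c hc2 t Ψ).1,
        (Finsupp.single (oflipCM c hc2 s (rt c Q₃ (arcType hw hk hc2 hwc 0))) (1 : ℤ) - Finsupp.single (rt c Q₃ (arcType hw hk hc2 hwc 0)) 1)) +
          Finsupp.single (rt c Q₃ (arcType hw hk hc2 hwc 0)) 1) -
      ((∑ s ∈ (rt c Q₄ (arcType hw hk hc2 hwc 0)).1 \ (oflipCM c hc2 t' Ψ).1,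
        (Finsupp.single (oflipCM c hc2 s (rt c Q₄ (arcType hw hk hc2 hwc 0))) (1 : ℤ) - Finsupp.single (rt c Q₄ (arcType hw hk hc2 hwc 0)) 1)) +
          Finsupp.single (rt c Q₄ (arcType hw hk hc2 hwc 0)) 1) ∈ L := by
  have e1 := single_sub_normalForm_mem_of_toward_of_unique hw hk hc2 hwc L htw Q₁ Ψ h₁
  have e2 := single_sub_normalForm_mem_of_toward_of_unique hw hk hc2 hwc L htw Q₂ _ h₂
  have e3 := single_sub_normalForm_mem_of_toward_of_unique hw hk hc2 hwc L htw Q₃ _ h₃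
  have e4 := single_sub_normalForm_mem_of_toward_of_unique hw hk hc2 hwc L htw Q₄ _ h₄
  have h := Submodule.sub_mem _ (Submodule.sub_mem _ hf (Submodule.add_mem _ e1 e2)) (Submodule.neg_mem _ (Submodule.add_mem _ e3 e4))
  convert h using 1
  simp only [gface]
  abel

end

end Summit.HodgeConjecture.CorCM.Census.CyclicCharacter
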